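import Summits.BirchSwinnertonDyer.BirchSwinnertonDyer.Theorems.KolyvaginRankRigidityAtTwoWalkEngineAdapter
import Summits.BirchSwinnertonDyer.BirchSwinnertonDyer.Theorems.KolyvaginRankRigidityAtTwoWalkBridge
import Literature.NumberTheory.EllipticCurves.CasselsTateSelmerKolyvaginValue
import Literature.NumberTheory.EllipticCurves.HeegnerPointsKolyvaginConjugation
import HarnessLib

/-!
# Crux U1 `KolyvaginBoundedDefectAtTwo` (stmt-BirchSwinnertonDyer-28083), LINE 17 `kolyvagin_swap` —
# DA · THE DEEP ENGINE ADAPTER AT 2 (deep homothety loss, deep sign transfer, and the tree's engine adapter read at a deep level)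

Pen `bsd-idea-1` g17 (`--supports stmt-BirchSwinnertonDyer-28083`, helper; file 1 of 2 — file 2 `KolyvaginRankRigidityAtTwoEngineSupplyAtTwo`
derives the pen's v8.x M-stub ES `EngineSupplyAtTwo` from `deepEngineAdapterAtTwo`; the conversion to landable form and the diagnosis of the
elaboration defects of the g16 text are the width seat `bsd-line-krr2-p2` g18's, `Cruxes/KolyvaginBoundedDefectAtTwo/ES-HANDOFF-g18.md`).
HONEST FRAMING: these are helper lemmas toward the typed sub-target ES of the pen's split of SWα⁗ (with SC `RegularWalk.shapeCutAtTwo`,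
p729679, and SRF `RegularWalk.shapeRefillAtTwo`, p728771); nothing here proves U1 `KolyvaginBoundedDefectAtTwo` (open: S0ʳ = Kolyvagin's
conjecture at 2 as INPUT, P372 = Gross 1991 Prop. 3.7(2) in print), a rung, or BSD.  **BSD is NOT proved.**

## Contents
* §1 **DL** `h1Eval_smul_eq_zero_of_deep` — DEEP HOMOTHETY LOSS: if `σ ∈ Γ_L` acts on `V[d]` as the scalar `λ` and `x ∈ H¹(L, V[n])`
  (`n ∣ d`) restricts to `0` on `Γ_{L(V[d])}`, then `(λ−1)·x` restricts to `0` on `Γ_{L(V[n])}` (evaluate at the commutator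
  `σρσ⁻¹ρ⁻¹ ∈ Γ_{L(V[d])}`: `[x, σρσ⁻¹ρ⁻¹] = σ[x,ρ] − [x,ρ]`); `exists_smul_eq_nine` realises `λ = 9 = 3²` on `E[2^I]` inside `Γ_K`
  (`RatClosure.exists_smul_eq_of_sq`), so the loss is `8`.
* §2 **deep sign transfer** `forall_h1Eval_conjAct_eq_of_dvd` — `τ_*` preserves "same restriction to `Γ_{K(E[d])}`" for classes of level
  `n ∣ d` (the adapter's `forall_h1Eval_conjAct_eq` is `d = 2n`).
* §3 **DA** `deepEngineAdapterAtTwo` — the tree adapter `RegularValueEngine.exists_regular_kolyvaginPrime_killing` VERBATIM except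
  `k+1 ≤ kolyvaginIndex` ↦ `I ≤ kolyvaginIndex` for a given deep level `I ≥ k+1`, surjectivity of `ρ̄_{E,2^m}` for all `m`, and the two
  cut laws read on `Γ_{K(E[2^I])}`.  NO PORT of the engine: run the tree adapter at level `k' := I − 1` on the INFLATED classes
  `ι_* y, ι_* p, ι_* q ∈ H¹(K, E[2^{I−1}])` (`torsionH1OfDvd`, `τ`-equivariant by `conjAct_torsionH1OfDvd`; the span `ι_* S` is finite and
  `τ`-stable); pull the cut laws back along `ι_*` (`h1Eval_torsionH1OfDvd` + injectivity of `E[2^k] ↪ E[2^{I−1}]`), the local statements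
  by `mem_torsionLocalKer_iff_torsionH1OfDvd_mem` (`Γ_{K_λ}` fixes `E[2^{I−1}]` at a Kolyvagin prime of index `≥ I`,
  `JET.GlobalDuality.galoisRep_toLocal_apply_eq_self`), and DESCEND regularity from level `2^{I−1}` to level `2^k` with
  `P := 2^{I−1−k} P'` (the `RegularValueEngineTwoLevel` pattern).
References (locators only; no cited FACT is declared): [cite: GrossLMS1991, §9 (pairing after Prop. 9.1)]
[cite: MazurRubin2004, §4.1, Prop. 4.1.5] [cite: McCallumLMS1991, §3 Prop. 3.1].
Design: no definitions; `K : Type`; the two `zsmul` transports inside §3 are stated first and closed by `map_zsmul` up to unfolding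
(the `ℤ`-action on `H¹` is not syntactically the `Module` path); axioms `propext`, `Classical.choice`, `Quot.sound` (checked).
-/

set_option autoImplicit false
-- the Theorems namespace of this sub repeats the summit name by design (D-0017 nested layout)
set_option linter.dupNamespace false

noncomputable section

open scoped Classical
open Function WeierstrassCurve Field Finset NumberField IsDedekindDomain
open Literature.NumberTheory Literature.NumberTheory.EllipticCurves Literature.NumberTheory.EllipticCurves.KolyvaginPairing
open Literature.NumberTheory.GaloisRepresentations
open Summit.BirchSwinnertonDyer.BirchSwinnertonDyer.Theorems

namespace Summit.BirchSwinnertonDyer.BirchSwinnertonDyer.Theorems.KolyvaginAtTwo.RegularValueEngine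

/-! ### §1 DL — deep homothety loss -/

/-- **DEEP HOMOTHETY LOSS.**  If `σ ∈ Γ_L` acts on `V[d]` as the scalar `λ` and `x ∈ H¹(L, V[n])`, `n ∣ d`, restricts to
zero on `Γ_{L(V[d])}`, then `(λ − 1)·x` restricts to zero on `Γ_{L(V[n])}`: for `ρ ∈ Γ_{L(V[n])}` the commutator
`σρσ⁻¹ρ⁻¹` lies in `Γ_{L(V[d])}` and `[x, σρσ⁻¹ρ⁻¹] = σ[x,ρ] − [x,ρ] = (λ−1)[x,ρ]`. [cite: GrossLMS1991, §9 (pairing after Prop. 9.1)] -/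
theorem h1Eval_smul_eq_zero_of_deep {L : Type} [Field L] (V : WeierstrassCurve L) {n d : ℤ} (hnd : n ∣ d)
    {σ : absoluteGaloisGroup L} {lam : ℤ} (hσ : ∀ P : geomTorsion V d, σ • P = lam • P)
    (x : galH1Torsion V n) (hx : ∀ ρ ∈ torsionFixing V d, h1Eval V n x ρ = 0) :
    ∀ ρ ∈ torsionFixing V n, h1Eval V n ((lam - 1) • x) ρ = 0 := by
  intro ρ hρ
  -- the commutator fixes `V[d]`
  have hcomm : σ * ρ * σ⁻¹ * ρ⁻¹ ∈ torsionFixing V d := by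
    rw [mem_torsionFixing_iff]
    intro P
    have hc : ∀ Q : geomTorsion V d, ρ • (lam • Q) = lam • (ρ • Q) := fun Q ↦
      map_zsmul (DistribSMul.toAddMonoidHom (geomTorsion V d) ρ) lam Q
    rw [mul_smul, mul_smul, mul_smul, hσ, ← hc, ← hσ, smul_inv_smul, smul_inv_smul]
  -- `σ` acts as `lam` on `V[n] ⊆ V[d]`
  have hσn : ∀ Q : geomTorsion V n, σ • Q = lam • Q := fun Q ↦ by
    have h := hσ (AddSubgroup.inclusion (V.geomTorsion_le_of_dvd hnd) Q)
    apply Subtype.ext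
    exact congrArg (fun X : geomTorsion V d ↦ (X : geomPoints V)) h
  have hconj : σ * ρ * σ⁻¹ ∈ torsionFixing V n := (torsionFixing_normal V n).conj_mem ρ hρ σ
  have h0 := hx _ hcomm
  rw [h1Eval_mul V n x hconj, h1Eval_inv V n x hρ, h1Eval_conj V n x σ hρ, hσn] at h0
  rw [h1Eval_zsmul V n _ x hρ, sub_eq_add_neg, add_zsmul, neg_zsmul, one_zsmul]
  exact h0

/-- **A homothety `9 = 3²` on `E[2^I]` inside `Γ_K`** (`[K:ℚ] = 2`, `ρ̄_{E,2^I}` onto): `P ↦ 3P` is an automorphism of the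
finite group `E[2^I]` (`gcd(3, 2^I) = 1`), and every square of `Aut E[2^I]` is realised by `Γ_K`
(`RatClosure.exists_smul_eq_of_sq`). [cite: GrossLMS1991, §9 (before Prop. 9.1)] -/
theorem exists_smul_eq_nine (W : WeierstrassCurve ℚ) [W.IsElliptic] (K : Type) [Field K] [NumberField K]
    (hK2 : Module.finrank ℚ K = 2) (I : ℕ) (hsurjI : W.HasSurjectiveModNGaloisRep ((2 ^ I : ℕ) : ℤ)) :
    ∃ σ : absoluteGaloisGroup K, ∀ P : geomTorsion (W.baseChange K) ((2 ^ I : ℕ) : ℤ), σ • P = (9 : ℤ) • P := by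
  haveI : NeZero (2 ^ I) := ⟨pow_ne_zero I two_ne_zero⟩
  haveI hEK : (W.baseChange K).IsElliptic := by unfold WeierstrassCurve.baseChange; infer_instance
  haveI : Finite (geomTorsion (W.baseChange K) ((2 ^ I : ℕ) : ℤ)) :=
    finite_geomTorsion_of_neZero (W.baseChange K) (2 ^ I)
  let f : geomTorsion (W.baseChange K) ((2 ^ I : ℕ) : ℤ) →+ geomTorsion (W.baseChange K) ((2 ^ I : ℕ) : ℤ) :=
    DistribSMul.toAddMonoidHom _ (3 : ℤ)
  have hf : ∀ P, f P = (3 : ℤ) • P := fun P ↦ rfl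
  have hkill : ∀ R : geomTorsion (W.baseChange K) ((2 ^ I : ℕ) : ℤ), ((2 ^ I : ℕ) : ℤ) • R = 0 := fun R ↦
    Subtype.ext (by exact_mod_cast (mem_geomTorsion_iff (W.baseChange K) _ _).mp R.2)
  have hinj : Function.Injective f := by
    intro P Q hPQ
    rw [hf, hf] at hPQ
    rw [← sub_eq_zero] at hPQ ⊢
    rw [← smul_sub] at hPQ
    set D := P - Q
    have h3 : addOrderOf D ∣ 3 := by exact_mod_cast (addOrderOf_dvd_iff_zsmul_eq_zero.mpr hPQ)
    have h2 : addOrderOf D ∣ 2 ^ I := by exact_mod_cast (addOrderOf_dvd_iff_zsmul_eq_zero.mpr (hkill D))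
    have hcop : Nat.gcd 3 (2 ^ I) = 1 := (Nat.Coprime.pow_right I (by norm_num : Nat.Coprime 3 2))
    have h1 : addOrderOf D ∣ 1 := hcop ▸ Nat.dvd_gcd h3 h2
    exact AddMonoid.addOrderOf_eq_one_iff.mp (Nat.dvd_one.mp h1)
  have hbij : Function.Bijective f := ⟨hinj, Finite.injective_iff_surjective.mp hinj⟩
  obtain ⟨g, hg⟩ := RatClosure.exists_smul_eq_of_sq (K := K) W hK2 hsurjI (AddEquiv.ofBijective f hbij)
  refine ⟨g, fun P ↦ ?_⟩
  rw [hg, AddEquiv.ofBijective_apply, AddEquiv.ofBijective_apply, hf, hf, smul_smul]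
  norm_num

/-! ### §2 Deep sign transfer -/

section SignTransfer

variable {K : Type} [Field K] [NumberField K] (W : WeierstrassCurve ℚ)

/-- `τ_*` preserves "same restriction to `Γ_{K(E[d])}`" for classes of level `n ∣ d` (an involutive lift of `τ` conjugates
`Γ_{K(E[d])}` into itself; `[τ_* x, ρ] = τ̃ [x, τ̃ρτ̃]`).  The adapter's `forall_h1Eval_conjAct_eq` is `d = 2n`.
[cite: GrossLMS1991, §9] -/
theorem forall_h1Eval_conjAct_eq_of_dvd (hK : IsImaginaryQuadratic K) {τ : K ≃ₐ[ℚ] K} (hτ : τ ≠ 1) {n d : ℤ}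
    (hnd : n ∣ d) {x x' : galH1Torsion (W.baseChange K) n}
    (h : ∀ ρ ∈ torsionFixing (W.baseChange K) d,
      h1Eval (W.baseChange K) n x ρ = h1Eval (W.baseChange K) n x' ρ) :
    ∀ ρ ∈ torsionFixing (W.baseChange K) d,
      h1Eval (W.baseChange K) n (conjAct W τ n x) ρ = h1Eval (W.baseChange K) n (conjAct W τ n x') ρ := by
  obtain ⟨c₀, hc₀⟩ := exists_isComplexConjugation (Rat.castHom ℝ)
  have ht : IsLiftOfAut τ (absGaloisTransport (K := ℚ) (L := K) c₀).toRingEquiv :=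
    RatClosure.isLiftOfAut_absGaloisTransport_of_isImaginaryQuadratic hK hτ hc₀
  have hinv : ∀ z, (absGaloisTransport (K := ℚ) (L := K) c₀).toRingEquiv
      ((absGaloisTransport (K := ℚ) (L := K) c₀).toRingEquiv z) = z := fun z ↦
    RatClosure.absGaloisTransport_absGaloisTransport_of_sq_eq_one hc₀.sq_eq_one z
  have hle : torsionFixing (W.baseChange K) d ≤ torsionFixing (W.baseChange K) n :=
    KolyvaginLowerBoundAtTwo.torsionFixing_le_of_dvd _ hnd
  intro ρ hρ
  rw [ht.h1Eval_conjAct W _ x (hle hρ), ht.h1Eval_conjAct W _ x' (hle hρ),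
    h _ (ht.conjGalCMH_mem_torsionFixing W hinv _ hρ)]

end SignTransfer

/-! ### §3 DA — the deep engine adapter, from the tree adapter at level `I − 1` on inflated classes -/

/-- **DA · DEEP ENGINE ADAPTER AT 2.**  `exists_regular_kolyvaginPrime_killing` (p691126) VERBATIM except: `k + 1 ≤ kolyvaginIndex` ↦
`I ≤ kolyvaginIndex` for a given deep level `I ≥ k+1`; surjectivity of `ρ̄_{E,2^m}` for all `m` (U1's habitat); the two cut laws read on
`Γ_{K(E[2^I])}` instead of `Γ_{K(E[2^{k+1}])}`.  Proof: the tree adapter at level `k' := I − 1` on the `torsionH1OfDvd`-inflated classes,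
everything pulled back along `ι_*`; regularity descends with `P := 2^{k'−k} P'`.
[cite: MazurRubin2004, §4.1, Prop. 4.1.5] [cite: McCallumLMS1991, §3 Prop. 3.1, (3)] [cite: GrossLMS1991, §9] -/
theorem deepEngineAdapterAtTwo :
  ∀ (W : WeierstrassCurve ℚ) [W.IsElliptic] [W.IsGloballyMinimal] [NeZero (W.conductorNorm ℤ)]
    (K : Type) [Field K] [NumberField K], IsImaginaryQuadratic K → Odd (NumberField.discr K) →
    SatisfiesHeegnerHypothesis (W.conductorNorm ℤ) K → ∀ {k I : ℕ}, 1 ≤ k → k + 1 ≤ I →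
    (∀ m : ℕ, W.HasSurjectiveModNGaloisRep (2 ^ m : ℕ)) →
    ∀ {τ : K ≃ₐ[ℚ] K}, τ ≠ 1 →
    ∀ (S : AddSubgroup (galH1Torsion (W.baseChange K) ((2 ^ k : ℕ) : ℤ))) [Finite S],
    (∀ x ∈ S, conjAct W τ ((2 ^ k : ℕ) : ℤ) x ∈ S) →
    ∀ {m : ℕ} (y : Fin m → galH1Torsion (W.baseChange K) ((2 ^ k : ℕ) : ℤ)), (∀ i, y i ∈ S) →
    ∀ (sy : Fin m → ℤ), (∀ i, conjAct W τ ((2 ^ k : ℕ) : ℤ) (y i) = sy i • y i) →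
    ∀ {p q : galH1Torsion (W.baseChange K) ((2 ^ k : ℕ) : ℤ)}, p ∈ S → q ∈ S → ∀ {sp sq : ℤ},
    conjAct W τ ((2 ^ k : ℕ) : ℤ) p = sp • p → conjAct W τ ((2 ^ k : ℕ) : ℤ) q = sq • q → ∀ (bnd : ℕ),
    ∃ ℓ : ℕ, bnd < ℓ ∧ Zhang2014.IsKolyvaginPrime (W.conductorNorm ℤ) W K 2 ℓ ∧
      I ≤ Zhang2014.kolyvaginIndex W 2 ℓ ∧
      (∃ (pl : HeightOneSpectrum (𝓞 ℚ)) (𝔓 : Ideal (absIntegers (𝓞 ℚ) ℚ)) (h : absoluteGaloisGroup ℚ),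
        (ℓ : 𝓞 ℚ) ∈ pl.asIdeal ∧ 𝔓 ∈ pl.primesAbove ∧ IsArithFrobAt (𝓞 ℚ) h 𝔓 ∧
        (∀ X : geomTorsion W ((2 ^ k : ℕ) : ℤ), h • h • X = X) ∧
        ∃ P : geomTorsion W ((2 ^ k : ℕ) : ℤ), (2 : ℤ) ^ (k - 1) • (P + h • P) ≠ 0) ∧
      ∀ v : HeightOneSpectrum (𝓞 K), (ℓ : 𝓞 K) ∈ v.asIdeal →
        (∀ i, galoisCohomology.localization ((W.baseChange K).torsionGaloisModule ((2 ^ k : ℕ) : ℤ))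
          (Sum.inr v : Place K) 1 (y i) = 0) ∧
        (∀ a : ℤ, a • galoisCohomology.localization ((W.baseChange K).torsionGaloisModule ((2 ^ k : ℕ) : ℤ))
            (Sum.inr v : Place K) 1 p = 0 ↔
          ∃ b : Fin m → ℤ, ∀ ρ ∈ torsionFixing (W.baseChange K) ((2 ^ I : ℕ) : ℤ),
            h1Eval (W.baseChange K) ((2 ^ k : ℕ) : ℤ) (a • p - ∑ i, b i • y i) ρ = 0) ∧
        (∀ a : ℤ, a • galoisCohomology.localization ((W.baseChange K).torsionGaloisModule ((2 ^ k : ℕ) : ℤ))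
            (Sum.inr v : Place K) 1 q = 0 ↔
          ∃ b : Fin m → ℤ, ∀ ρ ∈ torsionFixing (W.baseChange K) ((2 ^ I : ℕ) : ℤ),
            h1Eval (W.baseChange K) ((2 ^ k : ℕ) : ℤ) (a • q - ∑ i, b i • y i) ρ = 0) := by
  intro W _ _ _ K _ _ hK hodd hH k I hk hkI hsurj τ hτ S _ hSτ m y hy sy hyτ p q hp hq sp sq hpτ hqτ bnd
  classical
  haveI : Fact (Nat.Prime 2) := ⟨Nat.prime_two⟩
  haveI hEK : (W.baseChange K).IsElliptic := by unfold WeierstrassCurve.baseChange; infer_instance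
  obtain ⟨k', rfl⟩ : ∃ k', I = k' + 1 := ⟨I - 1, by omega⟩
  have hkk' : k ≤ k' := by omega
  have hk' : 1 ≤ k' := le_trans hk hkk'
  have hdvd : ((2 ^ k : ℕ) : ℤ) ∣ ((2 ^ k' : ℕ) : ℤ) := by exact_mod_cast pow_dvd_pow 2 hkk'
  have hle' : torsionFixing (W.baseChange K) ((2 ^ (k' + 1) : ℕ) : ℤ) ≤
      torsionFixing (W.baseChange K) ((2 ^ k' : ℕ) : ℤ) :=
    KolyvaginLowerBoundAtTwo.torsionFixing_le_of_dvd _ (by exact_mod_cast pow_dvd_pow 2 (Nat.le_succ k'))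
  -- ### the inflation `ι_* : H¹(K, E[2^k]) → H¹(K, E[2^k'])`
  set ι : galH1Torsion (W.baseChange K) ((2 ^ k : ℕ) : ℤ) →+ galH1Torsion (W.baseChange K) ((2 ^ k' : ℕ) : ℤ) :=
    torsionH1OfDvd (W.baseChange K) hdvd with hιdef
  set incl : geomTorsion (W.baseChange K) ((2 ^ k : ℕ) : ℤ) →+ geomTorsion (W.baseChange K) ((2 ^ k' : ℕ) : ℤ) :=
    AddSubgroup.inclusion ((W.baseChange K).geomTorsion_le_of_dvd hdvd) with hincl
  have hincl_inj : Function.Injective incl := AddSubgroup.inclusion_injective _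
  have hιeval : ∀ (x : galH1Torsion (W.baseChange K) ((2 ^ k : ℕ) : ℤ)),
      ∀ ρ ∈ torsionFixing (W.baseChange K) ((2 ^ k' : ℕ) : ℤ),
      h1Eval (W.baseChange K) ((2 ^ k' : ℕ) : ℤ) (ι x) ρ =
        incl (h1Eval (W.baseChange K) ((2 ^ k : ℕ) : ℤ) x ρ) := fun x ρ hρ ↦
    KolyvaginAtTwo.RegularValueEngine.h1Eval_torsionH1OfDvd (W.baseChange K) hdvd x hρ
  have hιτ : ∀ x, conjAct W τ ((2 ^ k' : ℕ) : ℤ) (ι x) = ι (conjAct W τ ((2 ^ k : ℕ) : ℤ) x) := fun x ↦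
    conjAct_torsionH1OfDvd W τ hdvd x
  -- ### the inflated span and data
  set S' : AddSubgroup (galH1Torsion (W.baseChange K) ((2 ^ k' : ℕ) : ℤ)) := S.map ι with hS'
  haveI : Finite S' := by
    refine Finite.of_surjective (fun s : S ↦ (⟨ι s, AddSubgroup.mem_map_of_mem ι s.2⟩ : S')) ?_
    rintro ⟨x, hx⟩
    obtain ⟨s, hs, rfl⟩ := AddSubgroup.mem_map.mp hx
    exact ⟨⟨s, hs⟩, rfl⟩
  have hS'τ : ∀ x ∈ S', conjAct W τ ((2 ^ k' : ℕ) : ℤ) x ∈ S' := by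
    intro x hx
    obtain ⟨s, hs, rfl⟩ := AddSubgroup.mem_map.mp hx
    rw [hιτ]
    exact AddSubgroup.mem_map_of_mem ι (hSτ s hs)
  have hy' : ∀ i, ι (y i) ∈ S' := fun i ↦ AddSubgroup.mem_map_of_mem ι (hy i)
  have hyτ' : ∀ i, conjAct W τ ((2 ^ k' : ℕ) : ℤ) (ι (y i)) = sy i • ι (y i) := fun i ↦ by
    rw [hιτ, hyτ, map_zsmul]
  have hpτ' : conjAct W τ ((2 ^ k' : ℕ) : ℤ) (ι p) = sp • ι p := by rw [hιτ, hpτ, map_zsmul]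
  have hqτ' : conjAct W τ ((2 ^ k' : ℕ) : ℤ) (ι q) = sq • ι q := by rw [hιτ, hqτ, map_zsmul]
  have hρ2 : W.HasSurjectiveModNGaloisRep 2 := by simpa using hsurj 1
  -- ### the tree's adapter at level `k'`
  obtain ⟨ℓ, hbnd, hKol, hidx, hreg, hloc⟩ :=
    KolyvaginAtTwo.RegularValueEngine.exists_regular_kolyvaginPrime_killing W hK hodd hH hk' hρ2 (hsurj (k' + 1)) hτ
      S' hS'τ (fun i ↦ ι (y i)) hy' sy hyτ' (AddSubgroup.mem_map_of_mem ι hp) (AddSubgroup.mem_map_of_mem ι hq)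
      hpτ' hqτ' bnd
  refine ⟨ℓ, hbnd, hKol, hidx, ?_, ?_⟩
  · -- ### regularity descends from level `2^k'` to level `2^k` (tree pattern of `RegularValueEngineTwoLevel`, `P := 2^(k'-k) P'`)
    obtain ⟨pl, 𝔓, h, hpl, h𝔓, hfrob, hinv, P', hP'⟩ := hreg
    have hleQ := W.geomTorsion_le_of_dvd hdvd
    refine ⟨pl, 𝔓, h, hpl, h𝔓, hfrob, fun X ↦ ?_, ?_⟩
    · have h1 := hinv ⟨(X : geomPoints W), hleQ X.2⟩
      have h2 : h • h • (X : geomPoints W) = X := congrArg Subtype.val h1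
      exact Subtype.ext h2
    · have h2P : (2 : ℤ) ^ (k' - k) • (P' : geomPoints W) ∈ geomTorsion W ((2 ^ k : ℕ) : ℤ) := by
        rw [mem_geomTorsion_iff, smul_smul,
          show ((2 ^ k : ℕ) : ℤ) * 2 ^ (k' - k) = ((2 ^ k' : ℕ) : ℤ) by
            push_cast; rw [← pow_add, Nat.add_sub_cancel' hkk']]
        exact (mem_geomTorsion_iff W _ _).mp P'.2
      refine ⟨⟨(2 : ℤ) ^ (k' - k) • (P' : geomPoints W), h2P⟩, fun h0 ↦ hP' ?_⟩
      obtain ⟨m, hm⟩ : ∃ m, k = m + 1 := ⟨k - 1, (Nat.sub_add_cancel hk).symm⟩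
      subst hm
      rw [Nat.add_sub_cancel] at h0
      have h1 : (2 : ℤ) ^ m • ((2 : ℤ) ^ (k' - (m + 1)) • (P' : geomPoints W) +
          h • ((2 : ℤ) ^ (k' - (m + 1)) • (P' : geomPoints W))) = 0 := by
        have h1' := congrArg Subtype.val h0
        simpa only [AddSubgroupClass.coe_zsmul, AddSubgroup.coe_add, AddSubgroup.torsionBy.coe_smul,
          ZeroMemClass.coe_zero] using h1'
      apply Subtype.ext
      rw [AddSubgroupClass.coe_zsmul, ZeroMemClass.coe_zero, AddSubgroup.coe_add, AddSubgroup.torsionBy.coe_smul,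
        show k' - 1 = m + (k' - (m + 1)) by omega, pow_add, mul_smul, smul_add,
        smul_comm ((2 : ℤ) ^ (k' - (m + 1))) h]
      exact h1
  · -- ### local statements pulled back along `ι_*`
    intro v hv
    haveI : CharZero (v.adicCompletion K) := charZero_of_injective_algebraMap (algebraMap K _).injective
    obtain ⟨hy0, hpcut, hqcut⟩ := hloc v hv
    have htriv : ∀ (g : absoluteGaloisGroup (v.adicCompletion K))
        (Q : geomTorsion (W.baseChange K) ((2 ^ k' : ℕ) : ℤ)), resGal (K := K) (v.adicCompletion K) g • Q = Q :=
      fun g Q ↦ by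
      rw [resGal_eq_absGaloisRestrict]
      exact Summit.BirchSwinnertonDyer.Rank1Residual.JET.GlobalDuality.galoisRep_toLocal_apply_eq_self W K hK hKol
        (Nat.le_of_succ_le hidx) v hv g Q
    have e1 : ∀ X : galH1Torsion (W.baseChange K) ((2 ^ k : ℕ) : ℤ),
        X ∈ (W.baseChange K).torsionLocalKer (v.adicCompletion K) ((2 ^ k : ℕ) : ℤ) ↔
          ι X ∈ (W.baseChange K).torsionLocalKer (v.adicCompletion K) ((2 ^ k' : ℕ) : ℤ) := fun X ↦
      mem_torsionLocalKer_iff_torsionH1OfDvd_mem (W.baseChange K) (v.adicCompletion K) (pow_dvd_pow 2 hkk')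
        (pow_ne_zero k two_ne_zero) (pow_ne_zero k' two_ne_zero) htriv X
    have hdict : ∀ X : galH1Torsion (W.baseChange K) ((2 ^ k : ℕ) : ℤ),
        galoisCohomology.localization ((W.baseChange K).torsionGaloisModule ((2 ^ k : ℕ) : ℤ))
            (Sum.inr v : Place K) 1 X = 0 ↔
          galoisCohomology.localization ((W.baseChange K).torsionGaloisModule ((2 ^ k' : ℕ) : ℤ))
            (Sum.inr v : Place K) 1 (ι X) = 0 := fun X ↦
      ((mem_torsionLocalKer_iff_res_eq_zero (W.baseChange K) (v.adicCompletion K) (k := 2 ^ k)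
          (pow_ne_zero k two_ne_zero) X).symm.trans
        ((e1 X).trans (mem_torsionLocalKer_iff_res_eq_zero (W.baseChange K) (v.adicCompletion K) (k := 2 ^ k')
          (pow_ne_zero k' two_ne_zero) (ι X))))
    have hdict' : ∀ (a : ℤ) (X : galH1Torsion (W.baseChange K) ((2 ^ k : ℕ) : ℤ)),
        a • galoisCohomology.localization ((W.baseChange K).torsionGaloisModule ((2 ^ k : ℕ) : ℤ))
            (Sum.inr v : Place K) 1 X = 0 ↔
          a • galoisCohomology.localization ((W.baseChange K).torsionGaloisModule ((2 ^ k' : ℕ) : ℤ))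
            (Sum.inr v : Place K) 1 (ι X) = 0 := fun a X ↦ by
      -- the two `zsmul` transports are stated first and proved by `map_zsmul` up to definitional unfolding (the `ℤ`-actions on
      -- `H¹` are not syntactically the `Module` path, so a direct `rw [← map_zsmul …]` does not find its pattern)
      have e1 : a • galoisCohomology.localization ((W.baseChange K).torsionGaloisModule ((2 ^ k : ℕ) : ℤ))
            (Sum.inr v : Place K) 1 X =
          galoisCohomology.localization ((W.baseChange K).torsionGaloisModule ((2 ^ k : ℕ) : ℤ))
            (Sum.inr v : Place K) 1 (a • X) :=
        (map_zsmul (galoisCohomology.localization ((W.baseChange K).torsionGaloisModule ((2 ^ k : ℕ) : ℤ))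
          (Sum.inr v : Place K) 1) a X).symm
      have e2 : a • galoisCohomology.localization ((W.baseChange K).torsionGaloisModule ((2 ^ k' : ℕ) : ℤ))
            (Sum.inr v : Place K) 1 (ι X) =
          galoisCohomology.localization ((W.baseChange K).torsionGaloisModule ((2 ^ k' : ℕ) : ℤ))
            (Sum.inr v : Place K) 1 (ι (a • X)) :=
        ((congrArg (galoisCohomology.localization ((W.baseChange K).torsionGaloisModule ((2 ^ k' : ℕ) : ℤ))
            (Sum.inr v : Place K) 1) (map_zsmul ι a X)).trans
          (map_zsmul (galoisCohomology.localization ((W.baseChange K).torsionGaloisModule ((2 ^ k' : ℕ) : ℤ))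
            (Sum.inr v : Place K) 1) a (ι X))).symm
      rw [e1, e2]
      exact hdict (a • X)
    have hpull : ∀ (a : ℤ) (X : galH1Torsion (W.baseChange K) ((2 ^ k : ℕ) : ℤ)) (b : Fin m → ℤ),
        ∀ ρ ∈ torsionFixing (W.baseChange K) ((2 ^ (k' + 1) : ℕ) : ℤ),
        (h1Eval (W.baseChange K) ((2 ^ k' : ℕ) : ℤ) (a • ι X - ∑ i, b i • ι (y i)) ρ = 0 ↔
          h1Eval (W.baseChange K) ((2 ^ k : ℕ) : ℤ) (a • X - ∑ i, b i • y i) ρ = 0) := by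
      intro a X b ρ hρ
      have hρk' : ρ ∈ torsionFixing (W.baseChange K) ((2 ^ k' : ℕ) : ℤ) := hle' hρ
      have hX : a • ι X - ∑ i, b i • ι (y i) = ι (a • X - ∑ i, b i • y i) := by
        simp only [map_sub, map_sum, map_zsmul]
      rw [hX, hιeval _ ρ hρk']
      exact ⟨fun h0 ↦ hincl_inj (by rw [h0, map_zero]), fun h0 ↦ by rw [h0, map_zero]⟩
    refine ⟨fun i ↦ (hdict (y i)).mpr (hy0 i), fun a ↦ ?_, fun a ↦ ?_⟩
    · refine (hdict' a p).trans ((hpcut a).trans (exists_congr fun b ↦ forall₂_congr fun ρ hρ ↦ ?_))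
      exact hpull a p b ρ hρ
    · refine (hdict' a q).trans ((hqcut a).trans (exists_congr fun b ↦ forall₂_congr fun ρ hρ ↦ ?_))
      exact hpull a q b ρ hρ

end Summit.BirchSwinnertonDyer.BirchSwinnertonDyer.Theorems.KolyvaginAtTwo.RegularValueEngine

end
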